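import Literature.Analysis.FluidPDE.KNSSRegularityPlanarOfSpace
import Mathlib.Analysis.Calculus.BumpFunction.Normed
import Mathlib.MeasureTheory.Integral.IntegralEqImproper
import HarnessLib

/-!
# Planar descent: bounded weak Navier–Stokes solutions independent of `x₂` restrict to `ℝ²`

Analysis/FluidPDE support file (everything proved; no definitions, no named facts), the converse
of `PlanarLiftWeak` (`IsBoundedWeakNSSolutionOn.planarLift`: bounded weak solutions lift from
`ℝ²` to `ℝ³`) in the same vocabulary (`projXY`, `embedXY`, `eZ`, `cylSplit` of
`PlanarLiftCalculus` / `CylindricalIntegration`; `IsVertInvariant`, `restrictXY` of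
`KNSSRegularityPlanarOfSpace`). For KNSS's class of bounded weak solutions
(`IsBoundedWeakNSSolutionOn`, Koch–Nadirashvili–Seregin–Šverák, Acta Math. 203 (2009) =
arXiv:0709.3599, §4 (ii), p. 8) it proves the step "`w` is independent of the `x₂`-variable;
applying Theorem 5.1 … to the field `(w₁, w₃)`" of the proof of Theorem 6.2 (p. 13) in the form:

* `IsBoundedWeakNSSolutionOn.restrictXY_of_isVertInvariant` — if `U` is a bounded weak
  solution on `ℝ³ × I` whose slices `U t`, `t ∈ I`, are vertically invariant
  (`U t (x + z e_z) = U t x`) and whose horizontal restriction `(t, w) ↦ π (U t (ι w))` is a.e.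
  strongly measurable on `I × ℝ²`, then the horizontal restriction is a bounded weak solution on
  `ℝ² × I` with the same viscosity (`…_of_continuousOn`: the measurability is automatic for
  jointly continuous `U`). The vertical velocity `U₂` is arbitrary and plays no role (a
  `2½`-dimensional flow, Majda–Bertozzi 2002, §2.3.1: the horizontal part solves planar
  Navier–Stokes, the vertical one is transported).

Proof: a planar test field `φ` on `I × ℝ²` (a scalar test function `θ` on `ℝ²`) is lifted to the
spatial field `χ(x₂) ι φ(t, π x)` (to `χ(x₂) θ(π x)`) with a normalised bump `χ`, `∫ χ = 1`
(`exists_contDiff_hasCompactSupport_integral_eq_one`). The lift is a space–time test field on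
`I × ℝ³` with divergence-free slices (`isSpaceTimeTestOn_bumpLiftZ`,
`isDivFree_bumpLiftZ_embedXY`: `div = χ (div φ) ∘ π + χ' ⟪e_z, ι φ⟫ = 0`); slice by slice
`∂ₜ`, `D`, `Δ` of the lift are `χ (∂ₜφ) ∘ π`, `χ (Dφ ∘ π)[π ·] + χ' (·)₂ ι φ ∘ π`,
`χ (Δφ) ∘ π + χ'' ι φ ∘ π` (`fderiv_bumpLiftZ_apply`, `laplacian_bumpLiftZ`); so Fubini over the
vertical fibres (`cylSplit`) turns the weak identity of `U` tested with the lift into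
`(∫χ)·(planar identity) + (∫χ')·(…) + (∫χ'')·(…)`, and `∫ χ' = ∫ χ'' = 0`
(`integral_bumpLiftZ_pairing_eq`, `IsWeaklyDivFree.restrictXY_of_isVertInvariant`).

The twin statement along the Lean coordinate `1` for jointly continuous fields, written directly
in coordinates, is `IsBoundedWeakNSSolutionOn.planarTrace_of_lineInvariant`
(`KNSSTypeIRateLiouvilleDescent`, the file feeding the Liouville step of KNSS Theorem 6.2); the
present file is the frame-`e_z` version matching `PlanarLiftWeak`, with the measurability of the
trace as the only regularity hypothesis; either is carried to any other axis by
`IsBoundedWeakNSSolutionOn.conj_linearIsometryEquiv` (`BoundedWeakIsometry`).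

## Mathlib / tree search

Tree: `IsBoundedWeakNSSolutionOn.planarLift` and its helpers `integrable_inner_of_bound`,
`integrable_inner_clm_apply_of_bound`, `integrable_clm_apply_of_hasCompactSupport`,
`IsSpaceTimeTestOn.clm_comp_left`, `timeDeriv_clm_comp_left`, `fderiv_clm_comp_left_apply`
(`PlanarLiftWeak`); `projXY`/`embedXY`/`eZ` calculus and `cylSplit` Fubini
(`PlanarLiftCalculus`, `CylindricalIntegration`); `IsVertInvariant`, `restrictXY`
(`KNSSRegularityPlanarOfSpace`); `laplacian_eq_sum_fderiv_fderiv_normed`,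
`IsSpaceTimeTestOn.timeDeriv_top` / `laplacian_top` (`HeatDuhamelBack`). Mathlib:
`ContDiffBump.normed` (`integral_normed`), `integral_eq_zero_of_hasDerivAt_of_integrable`,
`HasFDerivAt.smul`, `HasCompactSupport.intro`, `integral_prod_symm`,
`AEStronglyMeasurable.prodMk_left`.

## References

* G. Koch, N. Nadirashvili, G. Seregin, V. Šverák, *Liouville theorems for the Navier–Stokes
  equations and applications*, Acta Math. 203 (2009) 83–105 = arXiv:0709.3599: §4 (ii) p. 8
  (bounded weak solutions), proof of Theorem 6.2 p. 13. [KochNadirashviliSereginSverak2009]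
* A. J. Majda, A. L. Bertozzi, *Vorticity and Incompressible Flow*, CUP 2002, §2.3.1
  (`2½`-dimensional flows). [MajdaBertozziCUP2002]
-/

noncomputable section

open MeasureTheory Set Function Filter Topology TopologicalSpace Metric WithLp
open scoped RealInnerProductSpace ContDiff Laplacian

namespace Literature.Analysis.FluidPDE

/-! ### Calculus of the bump-modulated lift `x ↦ χ(x₂) Θ(π x)` -/

section BumpLift

variable {G : Type*} [NormedAddCommGroup G] [NormedSpace ℝ G]

/-- **Smoothness of the bump-modulated lift**: `x ↦ χ(x₂) • Θ(π x)` is `Cⁿ` if `χ` and `Θ` are.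
[folklore] -/
theorem contDiff_bumpLiftZ {n : WithTop ℕ∞} {χ : ℝ → ℝ} {Θ : (EuclideanSpace ℝ (Fin 2)) → G}
    (hχ : ContDiff ℝ n χ)
    (hΘ : ContDiff ℝ n Θ) : ContDiff ℝ n fun x : (EuclideanSpace ℝ (Fin 3)) => χ (x 2) • Θ (projXY x) :=
  (hχ.comp (EuclideanSpace.proj (2 : Fin 3) : (EuclideanSpace ℝ (Fin 3)) →L[ℝ] ℝ).contDiff).smul
    (hΘ.comp projXY.contDiff)

/-- **The derivative of the bump-modulated lift**:
`D(χ(x₂) Θ(π x))(v) = χ(x₂) DΘ(π x)(π v) + (χ'(x₂) v₂) Θ(π x)`. [folklore] -/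
theorem fderiv_bumpLiftZ_apply {χ : ℝ → ℝ} {Θ : (EuclideanSpace ℝ (Fin 2)) → G}
    {x : (EuclideanSpace ℝ (Fin 3))} {χ' : ℝ}
    (hχ : HasDerivAt χ χ' (x 2)) {Θ' : (EuclideanSpace ℝ (Fin 2)) →L[ℝ] G}
    (hΘ : HasFDerivAt Θ Θ' (projXY x)) (v : (EuclideanSpace ℝ (Fin 3))) :
    fderiv ℝ (fun y : (EuclideanSpace ℝ (Fin 3)) => χ (y 2) • Θ (projXY y)) x v =
      χ (x 2) • Θ' (projXY v) + (χ' * v 2) • Θ (projXY x) := by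
  have h1 : HasFDerivAt (fun y : (EuclideanSpace ℝ (Fin 3)) => χ (y 2))
      ((ContinuousLinearMap.smulRight (1 : ℝ →L[ℝ] ℝ) χ').comp
        (EuclideanSpace.proj (2 : Fin 3) : (EuclideanSpace ℝ (Fin 3)) →L[ℝ] ℝ)) x :=
    hχ.hasFDerivAt.comp x (EuclideanSpace.proj (2 : Fin 3) : (EuclideanSpace ℝ (Fin 3)) →L[ℝ] ℝ).hasFDerivAt
  have h2 : HasFDerivAt (fun y : (EuclideanSpace ℝ (Fin 3)) => Θ (projXY y)) (Θ'.comp projXY) x :=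
    hΘ.comp x projXY.hasFDerivAt
  have h3 : HasFDerivAt (fun y : (EuclideanSpace ℝ (Fin 3)) => χ (y 2) • Θ (projXY y))
      (χ (x 2) • Θ'.comp projXY + ((ContinuousLinearMap.smulRight (1 : ℝ →L[ℝ] ℝ) χ').comp
        (EuclideanSpace.proj (2 : Fin 3) : (EuclideanSpace ℝ (Fin 3)) →L[ℝ] ℝ)).smulRight
          (Θ (projXY x))) x :=
    h1.smul h2
  rw [h3.fderiv]
  simp [mul_comm χ']

/-- The derivative of the bump-modulated lift along a horizontal frame vector `e_i`, `i < 2`: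
`χ(x₂) DΘ(π x)(e'_i)`. [folklore] -/
theorem fderiv_bumpLiftZ_basisFun_castSucc {χ : ℝ → ℝ} {Θ : (EuclideanSpace ℝ (Fin 2)) → G}
    (hχ : Differentiable ℝ χ)
    (hΘ : Differentiable ℝ Θ) (i : Fin 2) :
    (fun x : (EuclideanSpace ℝ (Fin 3)) =>
      fderiv ℝ (fun y : (EuclideanSpace ℝ (Fin 3)) => χ (y 2) • Θ (projXY y)) x
        (EuclideanSpace.basisFun (Fin 3) ℝ (Fin.castSucc i))) =
      fun x => χ (x 2) • (fun w => fderiv ℝ Θ w (EuclideanSpace.basisFun (Fin 2) ℝ i)) (projXY x) := by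
  funext x
  rw [fderiv_bumpLiftZ_apply (hχ _).hasDerivAt (hΘ _).hasFDerivAt, EuclideanSpace.basisFun_apply,
    EuclideanSpace.basisFun_apply, projXY_single_castSucc]
  have h0 : (EuclideanSpace.single (Fin.castSucc i) (1 : ℝ) : (EuclideanSpace ℝ (Fin 3))) 2 = 0 := by
    fin_cases i <;> simp
  rw [h0, mul_zero, zero_smul, add_zero]

/-- The derivative of the bump-modulated lift along the vertical vector `e_z`:
`χ'(x₂) Θ(π x)`. [folklore] -/
theorem fderiv_bumpLiftZ_eZ {χ : ℝ → ℝ} {Θ : (EuclideanSpace ℝ (Fin 2)) → G} (hχ : Differentiable ℝ χ)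
    (hΘ : Differentiable ℝ Θ) :
    (fun x : (EuclideanSpace ℝ (Fin 3)) =>
      fderiv ℝ (fun y : (EuclideanSpace ℝ (Fin 3)) => χ (y 2) • Θ (projXY y)) x eZ) =
      fun x => deriv χ (x 2) • Θ (projXY x) := by
  funext x
  rw [fderiv_bumpLiftZ_apply (hχ _).hasDerivAt (hΘ _).hasFDerivAt, projXY_eZ, map_zero, smul_zero,
    zero_add]
  simp [eZ]

/-- **The Laplacian of the bump-modulated lift**:
`Δ(χ(x₂) Θ(π x)) = χ(x₂) (Δ Θ)(π x) + χ''(x₂) Θ(π x)` for `χ, Θ ∈ C²` (over the coordinate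
frame: the horizontal second derivatives fall on `Θ`, the vertical one on `χ`, and the mixed
terms vanish). [folklore] -/
theorem laplacian_bumpLiftZ {χ : ℝ → ℝ} {Θ : (EuclideanSpace ℝ (Fin 2)) → G} (hχ : ContDiff ℝ 2 χ)
    (hΘ : ContDiff ℝ 2 Θ)
    (x : (EuclideanSpace ℝ (Fin 3))) :
    Δ (fun y : (EuclideanSpace ℝ (Fin 3)) => χ (y 2) • Θ (projXY y)) x =
      χ (x 2) • Δ Θ (projXY x) + deriv (deriv χ) (x 2) • Θ (projXY x) := by
  classical
  have hΨ : ContDiff ℝ 2 fun y : (EuclideanSpace ℝ (Fin 3)) => χ (y 2) • Θ (projXY y) :=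
    contDiff_bumpLiftZ hχ hΘ
  have hχd : Differentiable ℝ χ := hχ.differentiable (by norm_num)
  have hΘd : Differentiable ℝ Θ := hΘ.differentiable (by norm_num)
  have hχ'1 : ContDiff ℝ 1 (deriv χ) := hχ.deriv'
  have hχ'd : Differentiable ℝ (deriv χ) := hχ'1.differentiable one_ne_zero
  rw [laplacian_eq_sum_fderiv_fderiv_normed (EuclideanSpace.basisFun (Fin 3) ℝ) hΨ,
    laplacian_eq_sum_fderiv_fderiv_normed (EuclideanSpace.basisFun (Fin 2) ℝ) hΘ,
    Fin.sum_univ_castSucc, Finset.smul_sum]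
  congr 1
  · refine Finset.sum_congr rfl fun i _ => ?_
    rw [fderiv_bumpLiftZ_basisFun_castSucc hχd hΘd i]
    have hΘi : Differentiable ℝ fun w => fderiv ℝ Θ w (EuclideanSpace.basisFun (Fin 2) ℝ i) :=
      ((hΘ.fderiv_right (m := 1) le_rfl).differentiable one_ne_zero).clm_apply
        (differentiable_const _)
    have h := congrFun (fderiv_bumpLiftZ_basisFun_castSucc hχd hΘi i) x
    simp only at h
    rw [h]
  · have he : EuclideanSpace.basisFun (Fin 3) ℝ (Fin.last 2) = eZ := by
      rw [EuclideanSpace.basisFun_apply]; rfl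
    rw [he, fderiv_bumpLiftZ_eZ hχd hΘd]
    have h := congrFun (fderiv_bumpLiftZ_eZ hχ'd hΘd) x
    simp only at h
    rw [h]

end BumpLift

/-! ### Smooth compactly supported bumps on the line -/

section Bump

/-- The derivative of a `C¹` compactly supported function on the line integrates to zero
(fundamental theorem of calculus). [folklore] -/
theorem integral_deriv_eq_zero_of_hasCompactSupport {χ : ℝ → ℝ} (hχ : ContDiff ℝ 1 χ)
    (hc : HasCompactSupport χ) : ∫ s, deriv χ s = 0 :=
  integral_eq_zero_of_hasDerivAt_of_integrable
    (fun s => ((hχ.differentiable one_ne_zero) s).hasDerivAt)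
    ((hχ.continuous_deriv le_rfl).integrable_of_hasCompactSupport hc.deriv)
    (hχ.continuous.integrable_of_hasCompactSupport hc)

/-- There is a smooth compactly supported `χ : ℝ → ℝ` with `∫ χ = 1` (a normalised bump,
Mathlib's `ContDiffBump.normed`). [folklore] -/
theorem exists_contDiff_hasCompactSupport_integral_eq_one :
    ∃ χ : ℝ → ℝ, ContDiff ℝ ∞ χ ∧ HasCompactSupport χ ∧ ∫ s, χ s = 1 := by
  let b : ContDiffBump (0 : ℝ) := ⟨1, 2, one_pos, one_lt_two⟩
  exact ⟨b.normed volume, b.contDiff_normed, b.hasCompactSupport_normed, b.integral_normed⟩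

end Bump

/-! ### Bump-modulated lifts of planar test fields are spatial test fields -/

section TestField

variable {G : Type*} [NormedAddCommGroup G] [NormedSpace ℝ G]

/-- **The bump-modulated lift of a planar space–time test field is a spatial space–time test
field**: if `φ ∈ C_c^∞(I × ℝ²)` and `χ ∈ C_c^∞(ℝ)`, then `(t, x) ↦ χ(x₂) φ(t, π x)` is in
`C_c^∞(I × ℝ³)` (its support lies in the image of `tsupport φ × tsupport χ` under
`((t, w), z) ↦ (t, ι w + z e_z)`). [folklore] -/
theorem isSpaceTimeTestOn_bumpLiftZ {I : Set ℝ} {hI : IsOpen I} {φ : ℝ → (EuclideanSpace ℝ (Fin 2)) → G}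
    (hφ : IsSpaceTimeTestOn (slab (EuclideanSpace ℝ (Fin 2)) I hI) φ) {χ : ℝ → ℝ} (hχ : ContDiff ℝ ∞ χ)
    (hχc : HasCompactSupport χ) :
    IsSpaceTimeTestOn (slab (EuclideanSpace ℝ (Fin 3)) I hI) (fun t x => χ (x 2) • φ t (projXY x)) := by
  set m : (ℝ × (EuclideanSpace ℝ (Fin 2))) × ℝ → ℝ × (EuclideanSpace ℝ (Fin 3)) :=
    fun p => (p.1.1, embedXY p.1.2 + p.2 • eZ) with hm
  have hmc : Continuous m := by
    refine continuous_fst.fst.prodMk ?_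
    exact (embedXY.continuous.comp continuous_fst.snd).add (continuous_snd.smul continuous_const)
  set K : Set (ℝ × (EuclideanSpace ℝ (Fin 3))) := m '' (tsupport (uncurry φ) ×ˢ tsupport χ) with hK
  have hKc : IsCompact K := (hφ.hasCompactSupport.prod hχc).image hmc
  have hzero : ∀ q : ℝ × (EuclideanSpace ℝ (Fin 3)), q ∉ K →
      uncurry (fun t x => χ (x 2) • φ t (projXY x)) q = 0 := by
    rintro ⟨t, x⟩ hq
    by_contra hne
    obtain ⟨h1, h2⟩ := smul_ne_zero_iff.1 hne
    refine hq ⟨((t, projXY x), x 2), ⟨subset_tsupport _ ?_, subset_tsupport _ h1⟩, ?_⟩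
    · exact h2
    · simp only [hm, embedXY_projXY_add]
  refine ⟨?_, HasCompactSupport.intro hKc hzero, ?_⟩
  · have heq : uncurry (fun t (x : (EuclideanSpace ℝ (Fin 3))) => χ (x 2) • φ t (projXY x)) =
        fun q : ℝ × (EuclideanSpace ℝ (Fin 3)) =>
          χ ((EuclideanSpace.proj (2 : Fin 3) : (EuclideanSpace ℝ (Fin 3)) →L[ℝ] ℝ) q.2) •
            uncurry φ (q.1, projXY q.2) := by
      funext q; obtain ⟨t, x⟩ := q; rfl
    rw [heq]
    exact (hχ.comp ((EuclideanSpace.proj (2 : Fin 3) :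
        (EuclideanSpace ℝ (Fin 3)) →L[ℝ] ℝ).contDiff.comp contDiff_snd)).smul
      (hφ.contDiff.comp (contDiff_fst.prodMk (projXY.contDiff.comp contDiff_snd)))
  · have h1 : tsupport (uncurry fun t (x : (EuclideanSpace ℝ (Fin 3))) => χ (x 2) • φ t (projXY x)) ⊆ K :=
      closure_minimal (fun q hq => by_contra fun h => hq (hzero q h)) hKc.isClosed
    refine h1.trans ?_
    rintro _ ⟨⟨⟨t, w⟩, z⟩, ⟨hx, -⟩, rfl⟩
    have ht : t ∈ I := mem_slab.1 (hφ.tsupport_subset hx)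
    exact mem_slab.2 ht

/-- **The bump-modulated lift of a divergence-free planar field is divergence free**:
`div (χ(x₂) ι Φ(π x)) = χ(x₂) (div Φ)(π x) + χ'(x₂) ⟪e_z, ι Φ⟫ = 0`. [folklore] -/
theorem isDivFree_bumpLiftZ_embedXY {Φ : (EuclideanSpace ℝ (Fin 2)) → (EuclideanSpace ℝ (Fin 2))}
    (hΦ : Differentiable ℝ Φ)
    (hdiv : VectorCalculus.IsDivFree Φ) {χ : ℝ → ℝ} (hχ : Differentiable ℝ χ) :
    VectorCalculus.IsDivFree (fun x : (EuclideanSpace ℝ (Fin 3)) => χ (x 2) • embedXY (Φ (projXY x))) := by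
  classical
  intro x
  have hΘ : Differentiable ℝ fun w => embedXY (Φ w) := embedXY.differentiable.comp hΦ
  rw [divergence_eq_sum_inner_fderiv (EuclideanSpace.basisFun (Fin 3) ℝ), Fin.sum_univ_castSucc]
  have he : EuclideanSpace.basisFun (Fin 3) ℝ (Fin.last 2) = eZ := by
    rw [EuclideanSpace.basisFun_apply]; rfl
  have hlast :
      ⟪eZ, fderiv ℝ (fun y : (EuclideanSpace ℝ (Fin 3)) => χ (y 2) • embedXY (Φ (projXY y))) x eZ⟫ = 0 := by
    have h := congrFun (fderiv_bumpLiftZ_eZ hχ hΘ) x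
    simp only at h
    rw [h, inner_smul_right, inner_embedXY_right, projXY_eZ, inner_zero_left, mul_zero]
  rw [he, hlast, add_zero]
  have hterm : ∀ i : Fin 2, ⟪EuclideanSpace.basisFun (Fin 3) ℝ (Fin.castSucc i),
      fderiv ℝ (fun y : (EuclideanSpace ℝ (Fin 3)) => χ (y 2) • embedXY (Φ (projXY y))) x
        (EuclideanSpace.basisFun (Fin 3) ℝ (Fin.castSucc i))⟫ =
      χ (x 2) * ⟪EuclideanSpace.basisFun (Fin 2) ℝ i,
        fderiv ℝ Φ (projXY x) (EuclideanSpace.basisFun (Fin 2) ℝ i)⟫ := by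
    intro i
    have h := congrFun (fderiv_bumpLiftZ_basisFun_castSucc hχ hΘ i) x
    simp only at h
    rw [h, inner_smul_right, fderiv_clm_comp_left_apply (hΦ _) embedXY, inner_embedXY_right,
      EuclideanSpace.basisFun_apply, EuclideanSpace.basisFun_apply, projXY_single_castSucc]
  simp_rw [hterm]
  rw [← Finset.mul_sum, ← divergence_eq_sum_inner_fderiv (EuclideanSpace.basisFun (Fin 2) ℝ),
    hdiv, mul_zero]

/-- The static bump-modulated lift of a compactly supported planar field has compact support
(inside the image of `tsupport Θ × tsupport χ` under `(w, z) ↦ ι w + z e_z`). [folklore] -/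
theorem hasCompactSupport_bumpLiftZ {Θ : (EuclideanSpace ℝ (Fin 2)) → G} (hΘ : HasCompactSupport Θ)
    {χ : ℝ → ℝ}
    (hχc : HasCompactSupport χ) :
    HasCompactSupport (fun x : (EuclideanSpace ℝ (Fin 3)) => χ (x 2) • Θ (projXY x)) := by
  set m : (EuclideanSpace ℝ (Fin 2)) × ℝ → (EuclideanSpace ℝ (Fin 3)) :=
    fun p => embedXY p.1 + p.2 • eZ with hm
  have hmc : Continuous m :=
    (embedXY.continuous.comp continuous_fst).add (continuous_snd.smul continuous_const)
  refine HasCompactSupport.intro ((hΘ.prod hχc).image hmc) fun x hx => ?_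
  by_contra hne
  obtain ⟨h1, h2⟩ := smul_ne_zero_iff.1 hne
  exact hx ⟨(projXY x, x 2), ⟨subset_tsupport _ h2, subset_tsupport _ h1⟩,
    by simp only [hm, embedXY_projXY_add]⟩

/-- The static bump-modulated lift of a planar test function is a test function on `ℝ³`.
[folklore] -/
theorem isTestFunctionOn_bumpLiftZ {Θ : (EuclideanSpace ℝ (Fin 2)) → G}
    (hΘ : FunctionSpaces.IsTestFunctionOn (⊤ : Opens (EuclideanSpace ℝ (Fin 2))) Θ) {χ : ℝ → ℝ}
    (hχ : ContDiff ℝ ∞ χ)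
    (hχc : HasCompactSupport χ) :
    FunctionSpaces.IsTestFunctionOn (⊤ : Opens (EuclideanSpace ℝ (Fin 3)))
      (fun x : (EuclideanSpace ℝ (Fin 3)) => χ (x 2) • Θ (projXY x)) :=
  ⟨contDiff_bumpLiftZ hχ hΘ.contDiff, hasCompactSupport_bumpLiftZ hΘ.hasCompactSupport hχc, by simp⟩

end TestField

/-! ### Descent of vertically invariant fields: the divergence constraint and the pairing -/

section Descent

/-- `‖π v‖ ≤ ‖v‖`. [folklore] -/
theorem norm_projXY_le (v : (EuclideanSpace ℝ (Fin 3))) : ‖projXY v‖ ≤ ‖v‖ := by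
  simpa using projXY.le_of_opNorm_le norm_projXY_clm_le v

/-- Along the vertical fibre over `w`, a vertically invariant field is constant, equal to its
value at `ι w`. [folklore] -/
theorem IsVertInvariant.apply_cylSplit_symm {α : Type*} [NormedAddCommGroup α] [NormedSpace ℝ α]
    {a : (EuclideanSpace ℝ (Fin 3)) → α} (hinv : IsVertInvariant a) (z : ℝ)
    (w : (EuclideanSpace ℝ (Fin 2))) :
    a (cylSplit.symm (z, w)) = a (embedXY w) := by
  rw [cylSplit_symm_eq, hinv]

/-- **Weak divergence-freeness descends along an ignorable coordinate.** If `a : ℝ³ → ℝ³` is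
bounded, a.e. strongly measurable, vertically invariant (`a (x + z e_z) = a x`) and weakly
divergence free, then its horizontal restriction `w ↦ π (a (ι w))` is weakly divergence free on
`ℝ²`: test `a` against `x ↦ χ(x₂) θ(π x)` for a normalised bump `χ` and integrate over the
fibres, `∫ (χ(z) Dθ(w)(π a) + χ'(z) a₂ θ(w)) dz = Dθ(w)(π a(ι w))`. [folklore] -/
theorem IsWeaklyDivFree.restrictXY_of_isVertInvariant
    {a : (EuclideanSpace ℝ (Fin 3)) → (EuclideanSpace ℝ (Fin 3))} (ha : IsWeaklyDivFree a)
    (ham : AEStronglyMeasurable a volume) {C : ℝ} (hC : ∀ x, ‖a x‖ ≤ C)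
    (hinv : IsVertInvariant a) : IsWeaklyDivFree (restrictXY a) := by
  obtain ⟨χ, hχ, hχc, hχ1⟩ := exists_contDiff_hasCompactSupport_integral_eq_one
  have hχd : Differentiable ℝ χ := hχ.differentiable (by simp)
  have hχ1' : ContDiff ℝ 1 χ := contDiff_infty.1 hχ 1
  intro θ hθ
  have hig : ∀ (g : (EuclideanSpace ℝ (Fin 2)) → ℝ) (x v : (EuclideanSpace ℝ (Fin 2))),
      ⟪v, gradient g x⟫ = fderiv ℝ g x v := fun g x v => by
    rw [real_inner_comm, inner_gradient_left]
  have hig3 : ∀ (g : (EuclideanSpace ℝ (Fin 3)) → ℝ) (x v : (EuclideanSpace ℝ (Fin 3))),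
      ⟪v, gradient g x⟫ = fderiv ℝ g x v := fun g x v => by
    rw [real_inner_comm, inner_gradient_left]
  have hθd : Differentiable ℝ θ := hθ.contDiff.differentiable (by simp)
  -- the spatial test function and the tested quantity
  set Θ₃ : (EuclideanSpace ℝ (Fin 3)) → ℝ := fun x => χ (x 2) • θ (projXY x) with hΘ₃
  have hΘ₃t : FunctionSpaces.IsTestFunctionOn (⊤ : Opens (EuclideanSpace ℝ (Fin 3))) Θ₃ :=
    isTestFunctionOn_bumpLiftZ hθ hχ hχc
  have h0 := ha Θ₃ hΘ₃t
  simp_rw [hig3] at h0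
  simp_rw [hig]
  set G : (EuclideanSpace ℝ (Fin 3)) → ℝ := fun x => fderiv ℝ Θ₃ x (a x) with hG
  have hGi : Integrable G :=
    integrable_clm_apply_of_hasCompactSupport (hΘ₃t.contDiff.continuous_fderiv (by simp))
      (hΘ₃t.hasCompactSupport.fderiv ℝ) ham hC
  change ∫ x, G x = 0 at h0
  rw [integral_eq_integral_cylSplit, Measure.volume_eq_prod,
    integral_prod_symm _ (integrable_comp_cylSplit_symm_iff.2 hGi)] at h0
  -- the fibre integral over `w`
  have hfib : ∀ w : (EuclideanSpace ℝ (Fin 2)), ∫ z : ℝ, G (cylSplit.symm (z, w)) =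
      fderiv ℝ θ w (restrictXY a w) := by
    intro w
    have hpt : ∀ z : ℝ, G (cylSplit.symm (z, w)) =
        χ z * fderiv ℝ θ w (restrictXY a w) + deriv χ z * (a (embedXY w) 2 * θ w) := by
      intro z
      simp only [hG, hΘ₃]
      rw [hinv.apply_cylSplit_symm, fderiv_bumpLiftZ_apply (hχd _).hasDerivAt (hθd _).hasFDerivAt]
      simp only [cylSplit_symm_apply_two, projXY_cylSplit_symm, smul_eq_mul, restrictXY_apply]
      ring
    simp_rw [hpt]
    have i1 : Integrable fun z : ℝ => χ z * fderiv ℝ θ w (restrictXY a w) :=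
      (hχ.continuous.integrable_of_hasCompactSupport hχc).mul_const _
    have i2 : Integrable fun z : ℝ => deriv χ z * (a (embedXY w) 2 * θ w) :=
      ((hχ.continuous_deriv (by simp)).integrable_of_hasCompactSupport hχc.deriv).mul_const _
    rw [integral_add i1 i2, integral_mul_const, integral_mul_const, hχ1,
      integral_deriv_eq_zero_of_hasCompactSupport hχ1' hχc]
    ring
  simp_rw [hfib] at h0
  exact h0

variable {I : Set ℝ} {hI : IsOpen I}

/-- **The spatial pairing of a vertically invariant field with a bump-modulated lift is the
planar pairing of its restriction** (one time slice). For `a : ℝ³ → ℝ³` bounded, a.e. strongly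
measurable and vertically invariant, a planar test field `φ` on `I × ℝ²`, a normalised bump `χ`
(`∫ χ = 1`) and `ψ(t, x) = χ(x₂) ι φ(t, π x)`:
`∫ (⟪a, ∂ₜψ⟫ + ⟪a, (a·∇)ψ⟫ + ν⟪a, Δψ⟫) dx = ∫ (⟪ā, ∂ₜφ⟫ + ⟪ā, (ā·∇)φ⟫ + ν⟪ā, Δφ⟫) dw` with
`ā = π ∘ a ∘ ι` — Fubini over the vertical fibres; the terms carrying `χ'(z) a₂` and `χ''(z)`
integrate to zero and `∫ χ = 1`. [folklore] -/
theorem integral_bumpLiftZ_pairing_eq {φ : ℝ → (EuclideanSpace ℝ (Fin 2)) → (EuclideanSpace ℝ (Fin 2))}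
    (hφ : IsSpaceTimeTestOn (slab (EuclideanSpace ℝ (Fin 2)) I hI) φ)
    {χ : ℝ → ℝ} (hχ : ContDiff ℝ ∞ χ) (hχc : HasCompactSupport χ) (hχ1 : ∫ s, χ s = 1)
    {a : (EuclideanSpace ℝ (Fin 3)) → (EuclideanSpace ℝ (Fin 3))} (ham : AEStronglyMeasurable a volume)
    {C : ℝ} (hC : ∀ x, ‖a x‖ ≤ C)
    (hinv : IsVertInvariant a) (ν t : ℝ) :
    ∫ x : (EuclideanSpace ℝ (Fin 3)),
        (⟪a x, timeDeriv (fun t (x : (EuclideanSpace ℝ (Fin 3))) =>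
            χ (x 2) • embedXY (φ t (projXY x))) t x⟫ +
        ⟪a x, convect a ((fun t (x : (EuclideanSpace ℝ (Fin 3))) =>
            χ (x 2) • embedXY (φ t (projXY x))) t) x⟫ +
        ν * ⟪a x, Δ ((fun t (x : (EuclideanSpace ℝ (Fin 3))) =>
            χ (x 2) • embedXY (φ t (projXY x))) t) x⟫) =
      ∫ w : (EuclideanSpace ℝ (Fin 2)), (⟪restrictXY a w, timeDeriv φ t w⟫ +
        ⟪restrictXY a w, convect (restrictXY a) (φ t) w⟫ +
        ν * ⟪restrictXY a w, Δ (φ t) w⟫) := by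
  set ψ : ℝ → (EuclideanSpace ℝ (Fin 3)) → (EuclideanSpace ℝ (Fin 3)) :=
    fun t x => χ (x 2) • embedXY (φ t (projXY x)) with hψdef
  set θ : ℝ → (EuclideanSpace ℝ (Fin 2)) → (EuclideanSpace ℝ (Fin 3)) := fun t w => embedXY (φ t w)
    with hθdef
  have hθ : IsSpaceTimeTestOn (slab (EuclideanSpace ℝ (Fin 2)) I hI) θ := hφ.clm_comp_left embedXY
  have hψ : IsSpaceTimeTestOn (slab (EuclideanSpace ℝ (Fin 3)) I hI) ψ := isSpaceTimeTestOn_bumpLiftZ hθ hχ hχc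
  have hψT : IsSpaceTimeTestOn (⊤ : Opens (ℝ × (EuclideanSpace ℝ (Fin 3)))) ψ := hψ.mono le_top
  have hχd : Differentiable ℝ χ := hχ.differentiable (by simp)
  have hχ1' : ContDiff ℝ 1 χ := contDiff_infty.1 hχ 1
  have hχ2 : ContDiff ℝ 2 χ := contDiff_infty.1 hχ 2
  have hχ' : ContDiff ℝ ∞ (deriv χ) := by
    have := hχ.iterate_deriv 1
    simpa using this
  have hχ'1 : ContDiff ℝ 1 (deriv χ) := contDiff_infty.1 hχ' 1
  have hφs : ContDiff ℝ ∞ (φ t) := hφ.contDiff_slice t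
  have hφd : Differentiable ℝ (φ t) := hφs.differentiable (by simp)
  have hφ2 : ∀ w, ContDiffAt ℝ 2 (φ t) w := fun w => (contDiff_infty.1 hφs 2).contDiffAt
  have hθs : ContDiff ℝ ∞ (θ t) := hθ.contDiff_slice t
  have hθ2 : ContDiff ℝ 2 (θ t) := contDiff_infty.1 hθs 2
  have hθd : Differentiable ℝ (θ t) := hθs.differentiable (by simp)
  -- Step 1: pointwise identities for the derivatives of `ψ t`
  have htd : ∀ x : (EuclideanSpace ℝ (Fin 3)),
      timeDeriv ψ t x = χ (x 2) • embedXY (timeDeriv φ t (projXY x)) := by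
    intro x
    rw [← hφ.timeDeriv_clm_comp_left embedXY t (projXY x)]
    change deriv (fun s => χ (x 2) • θ s (projXY x)) t = χ (x 2) • timeDeriv θ t (projXY x)
    exact ((hθ.hasDerivAt_time t (projXY x)).const_smul (χ (x 2))).deriv
  have hfd : ∀ x v : (EuclideanSpace ℝ (Fin 3)), fderiv ℝ (ψ t) x v =
      χ (x 2) • embedXY (fderiv ℝ (φ t) (projXY x) (projXY v)) +
        (deriv χ (x 2) * v 2) • embedXY (φ t (projXY x)) := by
    intro x v
    change fderiv ℝ (fun y : (EuclideanSpace ℝ (Fin 3)) => χ (y 2) • θ t (projXY y)) x v = _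
    rw [fderiv_bumpLiftZ_apply (hχd _).hasDerivAt (hθd _).hasFDerivAt,
      fderiv_clm_comp_left_apply (hφd _) embedXY]
  have hlap : ∀ x : (EuclideanSpace ℝ (Fin 3)), Δ (ψ t) x =
      χ (x 2) • embedXY (Δ (φ t) (projXY x)) +
        deriv (deriv χ) (x 2) • embedXY (φ t (projXY x)) := by
    intro x
    change Δ (fun y : (EuclideanSpace ℝ (Fin 3)) => χ (y 2) • θ t (projXY y)) x = _
    rw [laplacian_bumpLiftZ hχ2 hθ2,
      show Δ (θ t) (projXY x) = embedXY (Δ (φ t) (projXY x)) from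
        (hφ2 _).laplacian_CLM_comp_left]
  -- Step 2: integrability of the spatial integrand and Fubini over the fibres
  set H : (EuclideanSpace ℝ (Fin 3)) → ℝ := fun x => ⟪a x, timeDeriv ψ t x⟫ + ⟪a x, convect a (ψ t) x⟫ +
      ν * ⟪a x, Δ (ψ t) x⟫ with hHdef
  have hdt_c : Continuous (timeDeriv ψ t) := (hψT.timeDeriv_top.contDiff_slice t).continuous
  have hdt_s : HasCompactSupport (timeDeriv ψ t) := hψT.timeDeriv_top.hasCompactSupport_slice t
  have hD_c : Continuous (fderiv ℝ (ψ t)) := (hψ.contDiff_slice t).continuous_fderiv (by simp)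
  have hD_s : HasCompactSupport (fderiv ℝ (ψ t)) := (hψ.hasCompactSupport_slice t).fderiv ℝ
  have hL_c : Continuous (Δ (ψ t)) := (hψT.laplacian_top.contDiff_slice t).continuous
  have hL_s : HasCompactSupport (Δ (ψ t)) := hψT.laplacian_top.hasCompactSupport_slice t
  have hHi : Integrable H := by
    refine Integrable.add (Integrable.add ?_ ?_) (Integrable.const_mul ?_ ν)
    · exact integrable_inner_of_bound ham hC hdt_c hdt_s
    · exact integrable_inner_clm_apply_of_bound ham hC hD_c hD_s ham hC
    · exact integrable_inner_of_bound ham hC hL_c hL_s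
  change ∫ x, H x = _
  rw [integral_eq_integral_cylSplit, Measure.volume_eq_prod,
    integral_prod_symm _ (integrable_comp_cylSplit_symm_iff.2 hHi)]
  refine integral_congr_ae (Eventually.of_forall fun w => ?_)
  -- Step 3: the fibre integral at a fixed horizontal point `w`
  set A : ℝ := ⟪restrictXY a w, timeDeriv φ t w⟫ +
      ⟪restrictXY a w, convect (restrictXY a) (φ t) w⟫ + ν * ⟪restrictXY a w, Δ (φ t) w⟫ with hA
  set B : ℝ := a (embedXY w) 2 * ⟪restrictXY a w, φ t w⟫ with hB
  set D : ℝ := ν * ⟪restrictXY a w, φ t w⟫ with hD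
  have hHw : ∀ z : ℝ, H (cylSplit.symm (z, w)) =
      χ z * A + deriv χ z * B + deriv (deriv χ) z * D := by
    intro z
    simp only [hHdef, convect_apply]
    rw [hinv.apply_cylSplit_symm, htd, hfd, hlap]
    simp only [cylSplit_symm_apply_two, projXY_cylSplit_symm, inner_add_right, inner_smul_right,
      inner_embedXY_right, hA, hB, hD, convect_apply, restrictXY_apply]
    ring
  change ∫ z, H (cylSplit.symm (z, w)) = A
  simp_rw [hHw]
  have hχi : Integrable χ := hχ.continuous.integrable_of_hasCompactSupport hχc
  have hχ'i : Integrable (deriv χ) :=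
    (hχ.continuous_deriv (by simp)).integrable_of_hasCompactSupport hχc.deriv
  have hχ''i : Integrable (deriv (deriv χ)) :=
    (hχ'.continuous_deriv (by simp)).integrable_of_hasCompactSupport hχc.deriv.deriv
  have i1 : Integrable fun z : ℝ => χ z * A := hχi.mul_const _
  have i2 : Integrable fun z : ℝ => deriv χ z * B := hχ'i.mul_const _
  have i3 : Integrable fun z : ℝ => deriv (deriv χ) z * D := hχ''i.mul_const _
  have i12 : Integrable fun z : ℝ => χ z * A + deriv χ z * B := i1.add i2
  rw [integral_add i12 i3, integral_add i1 i2, integral_mul_const, integral_mul_const,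
    integral_mul_const, hχ1, integral_deriv_eq_zero_of_hasCompactSupport hχ1' hχc,
    integral_deriv_eq_zero_of_hasCompactSupport hχ'1 hχc.deriv]
  ring

/-- **Bounded weak Navier–Stokes solutions independent of one coordinate descend to the
plane** (KNSS 2009, proof of Theorem 6.2, p. 13: the planar Liouville Theorem 5.1 is applied to
the horizontal part of a spatial solution "independent of the `x₂`-variable"; here for KNSS's
class of bounded weak solutions, §4 (ii)). Let `U` be a bounded weak solution on `ℝ³ × I` with
viscosity `ν` whose slices `U t`, `t ∈ I`, are vertically invariant, and whose horizontal
restriction `(t, w) ↦ π (U t (ι w))` is a.e. strongly measurable on the slab `I × ℝ²` (automatic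
for continuous `U`). Then the horizontal restriction is a bounded weak solution on `ℝ² × I` with
the same viscosity: the bound restricts; weak divergence-freeness of a.e. slice descends
(`IsWeaklyDivFree.restrictXY_of_isVertInvariant`); and a divergence-free planar test field `φ`
is tested against the restriction by testing the divergence-free spatial field
`χ(x₂) ι φ(t, π x)`, `∫ χ = 1`, against `U` (`integral_bumpLiftZ_pairing_eq`,
`isDivFree_bumpLiftZ_embedXY`). The vertical component `U₂` plays no role. [cite: KochNadirashviliSereginSverak2009, proof of Thm 6.2 (arXiv p. 13) with §4 (ii) (p. 8)] -/
theorem IsBoundedWeakNSSolutionOn.restrictXY_of_isVertInvariant {ν : ℝ}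
    {U : ℝ → (EuclideanSpace ℝ (Fin 3)) → (EuclideanSpace ℝ (Fin 3))}
    (h : IsBoundedWeakNSSolutionOn I hI ν U) (hinv : ∀ t ∈ I, IsVertInvariant (U t))
    (hm : AEStronglyMeasurable (uncurry fun t => restrictXY (U t))
      ((volume : Measure (ℝ × (EuclideanSpace ℝ (Fin 2)))).restrict (I ×ˢ univ))) :
    IsBoundedWeakNSSolutionOn I hI ν (fun t => restrictXY (U t)) := by
  obtain ⟨hmeas, ⟨C, hC⟩, hdiv, hweak⟩ := h
  obtain ⟨χ, hχ, hχc, hχ1⟩ := exists_contDiff_hasCompactSupport_integral_eq_one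
  -- a.e. time slice of `U` is a.e. strongly measurable
  have hsl : ∀ᵐ t ∂((volume : Measure ℝ).restrict I), AEStronglyMeasurable (U t) volume := by
    have h1 : AEStronglyMeasurable (uncurry U) (((volume : Measure ℝ).restrict I).prod volume) := by
      rw [Measure.restrict_prod_eq_prod_univ, ← Measure.volume_eq_prod]
      exact hmeas
    exact h1.prodMk_left
  refine ⟨hm, ⟨C, fun t ht w => (norm_projXY_le _).trans (hC t ht _)⟩, ?_, fun φ hφ hφdiv => ?_⟩
  · filter_upwards [hdiv, hsl, ae_restrict_mem hI.measurableSet] with t ht hmt htI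
    exact ht.restrictXY_of_isVertInvariant hmt (hC t htI) (hinv t htI)
  · set ψ : ℝ → (EuclideanSpace ℝ (Fin 3)) → (EuclideanSpace ℝ (Fin 3)) :=
      fun t x => χ (x 2) • embedXY (φ t (projXY x)) with hψdef
    have hψ : IsSpaceTimeTestOn (slab (EuclideanSpace ℝ (Fin 3)) I hI) ψ :=
      isSpaceTimeTestOn_bumpLiftZ (hφ.clm_comp_left embedXY) hχ hχc
    have hψdiv : ∀ t, VectorCalculus.IsDivFree (ψ t) := fun t =>
      isDivFree_bumpLiftZ_embedXY ((hφ.contDiff_slice t).differentiable (by simp)) (hφdiv t)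
        (hχ.differentiable (by simp))
    rw [← hweak ψ hψ hψdiv]
    refine setIntegral_congr_ae hI.measurableSet ?_
    have hsl' : ∀ᵐ t ∂(volume : Measure ℝ), t ∈ I → AEStronglyMeasurable (U t) volume :=
      (ae_restrict_iff' hI.measurableSet).1 hsl
    filter_upwards [hsl'] with t ht htI
    exact (integral_bumpLiftZ_pairing_eq hφ hχ hχc hχ1 (ht htI) (hC t htI) (hinv t htI) ν t).symm

/-- **Planar descent for jointly continuous fields**: as
`IsBoundedWeakNSSolutionOn.restrictXY_of_isVertInvariant`, the measurability of the horizontal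
restriction being supplied by the joint continuity of `U` on the slab `I × ℝ³`. [cite: KochNadirashviliSereginSverak2009, proof of Thm 6.2 (arXiv p. 13) with §4 (ii) (p. 8)] -/
theorem IsBoundedWeakNSSolutionOn.restrictXY_of_isVertInvariant_of_continuousOn {ν : ℝ}
    {U : ℝ → EuclideanSpace ℝ (Fin 3) → EuclideanSpace ℝ (Fin 3)} (h : IsBoundedWeakNSSolutionOn I hI ν U)
    (hinv : ∀ t ∈ I, IsVertInvariant (U t)) (hcont : ContinuousOn (uncurry U) (I ×ˢ univ)) :
    IsBoundedWeakNSSolutionOn I hI ν (fun t => restrictXY (U t)) := by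
  refine h.restrictXY_of_isVertInvariant hinv (ContinuousOn.aestronglyMeasurable ?_
    (hI.measurableSet.prod MeasurableSet.univ))
  have heq : uncurry (fun t => restrictXY (U t)) =
      projXY ∘ uncurry U ∘ fun q : ℝ × EuclideanSpace ℝ (Fin 2) => (q.1, embedXY q.2) := by
    funext q; obtain ⟨t, w⟩ := q; rfl
  rw [heq]
  refine projXY.continuous.comp_continuousOn (hcont.comp ?_ fun q hq => ⟨hq.1, mem_univ _⟩)
  exact (continuous_fst.prodMk (embedXY.continuous.comp continuous_snd)).continuousOn

end Descent

end Literature.Analysis.FluidPDE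

end
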